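import Summits.CriticalPhenomena.PercolationContinuityZ3.Theorems.Transplant.SkelFrmBParamsLFA
import Summits.CriticalPhenomena.PercolationContinuityZ3.Theorems.Transplant.SkelNegBParamsRootArithA
import HarnessLib

/-!
# N2 (frames-only node `SamePDropOfSkeletonFrm₁`, OPEN), (F) value layer: **THE FACE UNITS** — the cell-agnostic numbers the face files read from N1's RETIRED
# (R)/(C) value files `SkelNegBParamsRootValsA` :45–:97 / `RootValsYA` :40–:60 / `RootVals` :130–:133, RE-HOMED (hp-8 g42 2026-08-23T07:10:36Z, F-DISCHARGE-MAP-N2;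
# lead g11 06:35:07Z): the functionals **`KS.Λ₀of/Λ₁of`**, the stride units **`KS.u₀A := s₀`, `KS.u₁A := s₁`**, **`units_eqA`** (WITHOUT its two N1 `b0TA`
# conjuncts — the face target box is now the K-G window `BSlot.small`), `DofA_eq'`, `lam_eqA`, the run origin's fine abscissa **`KS.FcA`** (`FcA_eq_lit`, `FcA_eq`)
# and the y′-origin's fine ordinate **`KS.F1cA`** (`F1cA_eq_lit`, `F1cA_eq`).  NOT re-homed (retired with N1's run-from-the-root architecture under (R-22)/K-G):
# the stride counts `NrOfA/NyOfA` and their specs, the run boxes `Wrun/Lbrun/pa*/la*/lb*`.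

MECHANICAL PORT in the (ζ″) shape (B′) by stmt-g19's `port_frm.py` (`--datans`, section variables inlined, `--upto-marker` before the stride counts) of the
two origin sections, plus the two functionals typed by hand (two lines each, N1 text with the N2 binders); `RootArithA.coarse_cancel` is N1's cell-free
arithmetic lemma, referenced fully qualified. Proofs, docstrings and citations are N1's, verbatim.
builds on p205010 (kernel theorem, internal audit signed; external expert review pending) — nothing in this file uses p205010; NOTHING is claimed about the
open node `SamePDropOfSkeletonFrm₁`.
Lane `prim-bschramm-*`, seat `prim-bschramm-p1` (gen 17; (F) value-layer pen per lead g11 06:35:07Z); helper file (`--supports stmt-CriticalPhenomena-4575 --as helper`).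
Non-vacuity: VALUE-level statements only (closed terms of the (ζ″) ledger; no window/region/seed/zone geometry row).
[cite: KozmaNitzan2024, §4 p. 28 ((32) at the root), Lemma 11 (p. 22: the target boxes)] [cite: MartineauTassion2017, §4.3 Lemma 4.2]
-/

noncomputable section

open scoped Classical

namespace Summit.CriticalPhenomena.PercolationContinuityZ3.Theorems.Transplant

namespace PlanarSkeletonFrm

namespace NegB

namespace KS

open Literature.Probability.Percolation Literature.Probability.LatticeModels SimpleGraph
open SkelConc (Consts)
open Skelφ.StepI (DataN)
open TwoAxis.Para (modulus)
open Neg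

/-! ## §0 The two functionals (re-homed from N1 part RootVals) -/

/-- **The along functional** `Λ₀(y) := v_β·y₀ − v_L·y₁` (N1 `KS.Λ₀of`, part RootVals :130, cell-free; re-homed here). [this work] -/
def Λ₀of (κ : Consts) {V : Type} [DecidableEq V] [Countable V] {G : SimpleGraph V} [G.LocallyFinite] (Φ : PlanarSkeletonFrm G) (t : V) (p : unitInterval) (D : Skelφ.StepI.DataNS V) (g : ℕ) (f : ℕ) (y : Site 2) : ℤ :=
  Skelφ.NegPrm.vβOf (nL κ Φ t p D g f) (hL κ Φ t p D g f) (ℓL κ Φ t p D g f) (vL κ Φ t p D g f) * y 0 - vL κ Φ t p D g f * y 1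

/-- **The transverse functional** `Λ₁(y) := n_L·y₁ − h_L·y₀` (N1 `KS.Λ₁of`, part RootVals :133, cell-free; re-homed here). [this work] -/
def Λ₁of (κ : Consts) {V : Type} [DecidableEq V] [Countable V] {G : SimpleGraph V} [G.LocallyFinite] (Φ : PlanarSkeletonFrm G) (t : V) (p : unitInterval) (D : Skelφ.StepI.DataNS V) (g : ℕ) (f : ℕ) (y : Site 2) : ℤ := (nL κ Φ t p D g f : ℤ) * y 1 - hL κ Φ t p D g f * y 0

/-! ## §1 The x-run units and origin (N1 part RootVals-A §Origin, minus the target-box conjuncts and the stride count) -/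
/-- **The stride unit along axis `0` of the (ζ′) chain: `u₀A := s₀`** (one period = `s₀` cells; `c₀ = A·u₀A`, `r₀ = K·u₀A`). [this work] -/
def u₀A (κ : Consts) {V : Type} [DecidableEq V] [Countable V] {G : SimpleGraph V} [G.LocallyFinite] (Φ : PlanarSkeletonFrm G) (t : V) (p : unitInterval) (D : Skelφ.StepI.DataNS V) (g : ℕ) (f : ℕ) : ℤ := (((fcellsA κ Φ t p D g f).s 0 : ℕ) : ℤ)

/-- **The stride unit along axis `1` of the (ζ′) chain: `u₁A := s₁`.** [this work] -/
def u₁A (κ : Consts) {V : Type} [DecidableEq V] [Countable V] {G : SimpleGraph V} [G.LocallyFinite] (Φ : PlanarSkeletonFrm G) (t : V) (p : unitInterval) (D : Skelφ.StepI.DataNS V) (g : ℕ) (f : ℕ) : ℤ := (((fcellsA κ Φ t p D g f).s 1 : ℕ) : ℤ)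

/-- The (ζ′) literals in stride units: `c₀ = A·u₀A`, `c₁ = A·u₁A`, `r₀ = 40Kq·u₀A`, `r₁ = 40Kq·u₁A`, `1 ≤ u₀A`, `1 ≤ u₁A` (N1's two target-box conjuncts are
RE-HOMED to the K-G window `BSlot.small` and therefore dropped — hp-8 g42 07:10:36Z). [folklore] -/
theorem units_eqA (κ : Consts) {V : Type} [DecidableEq V] [Countable V] {G : SimpleGraph V} [G.LocallyFinite] (Φ : PlanarSkeletonFrm G) (t : V) (p : unitInterval) (D : Skelφ.StepI.DataNS V) (g : ℕ) (f : ℕ) : 20 * ((fcellsA κ Φ t p D g f).K : ℤ) * (((fcellsA κ Φ t p D g f).s 0 : ℕ) : ℤ) = Aof κ * u₀A κ Φ t p D g f ∧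
    20 * ((fcellsA κ Φ t p D g f).K : ℤ) * (((fcellsA κ Φ t p D g f).s 1 : ℕ) : ℤ) = Aof κ * u₁A κ Φ t p D g f ∧
    ((fcellsA κ Φ t p D g f).r 0 : ℤ) = 40 * (Neg.Kq κ : ℤ) * u₀A κ Φ t p D g f ∧ ((fcellsA κ Φ t p D g f).r 1 : ℤ) = 40 * (Neg.Kq κ : ℤ) * u₁A κ Φ t p D g f ∧
    1 ≤ u₀A κ Φ t p D g f ∧ 1 ≤ u₁A κ Φ t p D g f := by
  have hr := (fcellsA_K κ Φ t p D g f).2.2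
  have hs0 : (1 : ℤ) ≤ (((fcellsA κ Φ t p D g f).s 0 : ℕ) : ℤ) := by exact_mod_cast (fcellsA κ Φ t p D g f).hs 0
  have hs1 : (1 : ℤ) ≤ (((fcellsA κ Φ t p D g f).s 1 : ℕ) : ℤ) := by exact_mod_cast (fcellsA κ Φ t p D g f).hs 1
  unfold u₀A u₁A
  refine ⟨c_eq_A_mul_s κ Φ t p D g f 0, c_eq_A_mul_s κ Φ t p D g f 1, ?_, ?_, hs0, hs1⟩
  · rw [hr 0, Neg.K_eq]; push_cast; ring
  · rw [hr 1, Neg.K_eq]; push_cast; ring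

/-- `D_A = A²·m`. [folklore] -/
theorem DofA_eq' (κ : Consts) {V : Type} [DecidableEq V] [Countable V] {G : SimpleGraph V} [G.LocallyFinite] (Φ : PlanarSkeletonFrm G) (t : V) (p : unitInterval) (D : Skelφ.StepI.DataNS V) (g : ℕ) (f : ℕ) : Skelφ.NegPrm.DofA (Aof κ) (nL κ Φ t p D g f) (hL κ Φ t p D g f) (ℓL κ Φ t p D g f) (vL κ Φ t p D g f) =
    (Aof κ) ^ 2 * modulus (nL κ Φ t p D g f) (hL κ Φ t p D g f) (vL κ Φ t p D g f) (Skelφ.NegPrm.vβOf (nL κ Φ t p D g f) (hL κ Φ t p D g f) (ℓL κ Φ t p D g f) (vL κ Φ t p D g f)) :=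
  Skelφ.NegPrm.DofA_eq _ _ _ _ _

/-- `lam0 A v_L v_β y = A·Λ₀(y)`, `lam1 A n_L h_L y = A·Λ₁(y)`. [folklore] -/
theorem lam_eqA (κ : Consts) {V : Type} [DecidableEq V] [Countable V] {G : SimpleGraph V} [G.LocallyFinite] (Φ : PlanarSkeletonFrm G) (t : V) (p : unitInterval) (D : Skelφ.StepI.DataNS V) (g : ℕ) (f : ℕ) (y : Site 2) :
    TwoAxis.Para.lam0 (Aof κ) (vL κ Φ t p D g f) (Skelφ.NegPrm.vβOf (nL κ Φ t p D g f) (hL κ Φ t p D g f) (ℓL κ Φ t p D g f) (vL κ Φ t p D g f)) y = Aof κ * Λ₀of κ Φ t p D g f y ∧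
      TwoAxis.Para.lam1 (Aof κ) (nL κ Φ t p D g f : ℤ) (hL κ Φ t p D g f) y = Aof κ * Λ₁of κ Φ t p D g f y := ⟨rfl, rfl⟩

/-- **The run origin's fine abscissa of the (ζ′) chain** `FcA(y) := coarse c₀ (D_A/2) D_A (lam0 A v_L v_β y)` (p3's literal over `prFA`). [this work] -/
def FcA (κ : Consts) {V : Type} [DecidableEq V] [Countable V] {G : SimpleGraph V} [G.LocallyFinite] (Φ : PlanarSkeletonFrm G) (t : V) (p : unitInterval) (D : Skelφ.StepI.DataNS V) (g : ℕ) (f : ℕ) (y : Site 2) : ℤ :=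
  TwoAxis.Para.coarse (20 * ((fcellsA κ Φ t p D g f).K : ℤ) * (((fcellsA κ Φ t p D g f).s 0 : ℕ) : ℤ))
    (Skelφ.NegPrm.DofA (Aof κ) (nL κ Φ t p D g f) (hL κ Φ t p D g f) (ℓL κ Φ t p D g f) (vL κ Φ t p D g f) / 2)
    (Skelφ.NegPrm.DofA (Aof κ) (nL κ Φ t p D g f) (hL κ Φ t p D g f) (ℓL κ Φ t p D g f) (vL κ Φ t p D g f))
    (TwoAxis.Para.lam0 (Aof κ) (vL κ Φ t p D g f) (Skelφ.NegPrm.vβOf (nL κ Φ t p D g f) (hL κ Φ t p D g f) (ℓL κ Φ t p D g f) (vL κ Φ t p D g f)) y)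

/-- `FcA(y)` in the literal RootArith-A shape `(A·u₀A·(A·Λ₀(y)) + A²m/2)/(A²m)`. [folklore] -/
theorem FcA_eq_lit (κ : Consts) {V : Type} [DecidableEq V] [Countable V] {G : SimpleGraph V} [G.LocallyFinite] (Φ : PlanarSkeletonFrm G) (t : V) (p : unitInterval) (D : Skelφ.StepI.DataNS V) (g : ℕ) (f : ℕ) (y : Site 2) : FcA κ Φ t p D g f y =
    (Aof κ * u₀A κ Φ t p D g f * (Aof κ * Λ₀of κ Φ t p D g f y) +
        (Aof κ) ^ 2 * modulus (nL κ Φ t p D g f) (hL κ Φ t p D g f) (vL κ Φ t p D g f) (Skelφ.NegPrm.vβOf (nL κ Φ t p D g f) (hL κ Φ t p D g f) (ℓL κ Φ t p D g f) (vL κ Φ t p D g f)) / 2) /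
      ((Aof κ) ^ 2 * modulus (nL κ Φ t p D g f) (hL κ Φ t p D g f) (vL κ Φ t p D g f) (Skelφ.NegPrm.vβOf (nL κ Φ t p D g f) (hL κ Φ t p D g f) (ℓL κ Φ t p D g f) (vL κ Φ t p D g f))) := by
  unfold FcA TwoAxis.Para.coarse
  rw [(units_eqA κ Φ t p D g f).1, DofA_eq', (lam_eqA κ Φ t p D g f y).1]

/-- **`FcA(y) = (2·u₀A·Λ₀(y) + m)/(2m)`** (`A = 20K` is even and cancels). [folklore] -/
theorem FcA_eq (κ : Consts) {V : Type} [DecidableEq V] [Countable V] {G : SimpleGraph V} [G.LocallyFinite] (Φ : PlanarSkeletonFrm G) (t : V) (p : unitInterval) (D : Skelφ.StepI.DataNS V) (g : ℕ) (f : ℕ) (y : Site 2) : FcA κ Φ t p D g f y =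
    (2 * u₀A κ Φ t p D g f * Λ₀of κ Φ t p D g f y + modulus (nL κ Φ t p D g f) (hL κ Φ t p D g f) (vL κ Φ t p D g f) (vβL κ Φ t p D g f)) /
      (2 * modulus (nL κ Φ t p D g f) (hL κ Φ t p D g f) (vL κ Φ t p D g f) (vβL κ Φ t p D g f)) := by
  have hAe : 2 ∣ Aof κ := ⟨10 * (Neg.K κ : ℤ), by rw [Aof_eq_K]; ring⟩
  unfold FcA TwoAxis.Para.coarse
  rw [(units_eqA κ Φ t p D g f).1, DofA_eq', (lam_eqA κ Φ t p D g f y).1]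
  exact PlanarSkeletonNeg.NegB.RootArithA.coarse_cancel (Aof_pos κ).1 hAe

/-! ## §2 The y′-origin (N1 part RootVals-YA, minus the stride count) -/
/-- **The y′-origin's fine ordinate of the (ζ′) chain** `F1cA(y) := coarse c₁ (D_A/2) D_A (lam1 A n_L h_L y)` (p3's literal over `prFA`). [this work] -/
def F1cA (κ : Consts) {V : Type} [DecidableEq V] [Countable V] {G : SimpleGraph V} [G.LocallyFinite] (Φ : PlanarSkeletonFrm G) (t : V) (p : unitInterval) (D : Skelφ.StepI.DataNS V) (g : ℕ) (f : ℕ) (y : Site 2) : ℤ :=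
  TwoAxis.Para.coarse (20 * ((fcellsA κ Φ t p D g f).K : ℤ) * (((fcellsA κ Φ t p D g f).s 1 : ℕ) : ℤ))
    (Skelφ.NegPrm.DofA (Aof κ) (nL κ Φ t p D g f) (hL κ Φ t p D g f) (ℓL κ Φ t p D g f) (vL κ Φ t p D g f) / 2)
    (Skelφ.NegPrm.DofA (Aof κ) (nL κ Φ t p D g f) (hL κ Φ t p D g f) (ℓL κ Φ t p D g f) (vL κ Φ t p D g f))
    (TwoAxis.Para.lam1 (Aof κ) (nL κ Φ t p D g f : ℤ) (hL κ Φ t p D g f) y)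

/-- `F1cA(y)` in the literal RootArith-A shape. [folklore] -/
theorem F1cA_eq_lit (κ : Consts) {V : Type} [DecidableEq V] [Countable V] {G : SimpleGraph V} [G.LocallyFinite] (Φ : PlanarSkeletonFrm G) (t : V) (p : unitInterval) (D : Skelφ.StepI.DataNS V) (g : ℕ) (f : ℕ) (y : Site 2) : F1cA κ Φ t p D g f y =
    (Aof κ * u₁A κ Φ t p D g f * (Aof κ * Λ₁of κ Φ t p D g f y) +
        (Aof κ) ^ 2 * modulus (nL κ Φ t p D g f) (hL κ Φ t p D g f) (vL κ Φ t p D g f) (Skelφ.NegPrm.vβOf (nL κ Φ t p D g f) (hL κ Φ t p D g f) (ℓL κ Φ t p D g f) (vL κ Φ t p D g f)) / 2) /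
      ((Aof κ) ^ 2 * modulus (nL κ Φ t p D g f) (hL κ Φ t p D g f) (vL κ Φ t p D g f) (Skelφ.NegPrm.vβOf (nL κ Φ t p D g f) (hL κ Φ t p D g f) (ℓL κ Φ t p D g f) (vL κ Φ t p D g f))) := by
  unfold F1cA TwoAxis.Para.coarse
  rw [(units_eqA κ Φ t p D g f).2.1, DofA_eq', (lam_eqA κ Φ t p D g f y).2]

/-- **`F1cA(y) = (2·u₁A·Λ₁(y) + m)/(2m)`** (`A = 20K` is even and cancels). [folklore] -/
theorem F1cA_eq (κ : Consts) {V : Type} [DecidableEq V] [Countable V] {G : SimpleGraph V} [G.LocallyFinite] (Φ : PlanarSkeletonFrm G) (t : V) (p : unitInterval) (D : Skelφ.StepI.DataNS V) (g : ℕ) (f : ℕ) (y : Site 2) : F1cA κ Φ t p D g f y =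
    (2 * u₁A κ Φ t p D g f * Λ₁of κ Φ t p D g f y + modulus (nL κ Φ t p D g f) (hL κ Φ t p D g f) (vL κ Φ t p D g f) (vβL κ Φ t p D g f)) /
      (2 * modulus (nL κ Φ t p D g f) (hL κ Φ t p D g f) (vL κ Φ t p D g f) (vβL κ Φ t p D g f)) := by
  have hAe : 2 ∣ Aof κ := ⟨10 * (Neg.K κ : ℤ), by rw [Aof_eq_K]; ring⟩
  unfold F1cA TwoAxis.Para.coarse
  rw [(units_eqA κ Φ t p D g f).2.1, DofA_eq', (lam_eqA κ Φ t p D g f y).2]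
  exact PlanarSkeletonNeg.NegB.RootArithA.coarse_cancel (Aof_pos κ).1 hAe

end KS

end NegB

end PlanarSkeletonFrm

end Summit.CriticalPhenomena.PercolationContinuityZ3.Theorems.Transplant

end
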